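import Literature.Analysis.Convexity.AnisotropicIsoperimetric
import Literature.MathematicalPhysics.StatisticalMechanics.FccWulffBodyVolume
import Literature.MathematicalPhysics.StatisticalMechanics.BarlowTexturedSet
import Literature.Geometry.DiscreteGeometry.LayerShellPatterns
import Mathlib.Analysis.Normed.Module.FiniteDimension
import Summits.Ventures.Crystal3D.Theses.StickyWulffConstant

/-!
# `PolycrystalWulffBound`, single grain: the Wulff inequality for the fcc tension

Route `StickyWulffConstant` of the venture `Summits/Ventures/Crystal3D`, crux `PolycrystalWulffBound`
(item `stmt-Ventures-19482`, continuum regime P). For ONE grain (`n = 1`, no walls) the crux is the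
anisotropic isoperimetric (Wulff) inequality for the fcc broken-bond tension in orientation `A`:

  `6·2^{1/3}·(√2·|G|)^{2/3} = 3·∛32·|G|^{2/3} ≤ Per_{W_A}(G)`,

where `W_A = {y | ∀ ν, ⟪y, ν⟫ ≤ Φ(A⁻¹ν)}`, `Φ(ν) = (√2/4) Σ_{w ∈ Λ₀, ‖w‖ = 1} |⟪w, ν⟫|`
(`Λ₀ = fccStacking 1 √(2/3)`), and `Per_K` is the distributional `K`-perimeter — all written EXACTLY
as in the `let`-bindings of the crux, so that a prover of P can discharge the single-grain case by
`exact polycrystalWulffBound_singleGrain A hG hvol`. This is the tribunal's rung P₁ (J addendum 1 (3),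
"Wulff inequality, n = 1") — PROVED, via the tree theorem
`Literature.Analysis.Convexity.anisotropic_isoperimetric_inequality` (Brunn–Minkowski route).

Contents: the unit shell of `Λ₀` is an isometric image of the cuboctahedron `fccKissingPattern`
(`exists_linearIsometryEquiv_unitShell_eq`), hence `Φ = φ_fcc ∘ L⁻¹`
(`phiBarlow_eq_phiFcc`) and `W_A = (A ∘ L)(W_cubic)` with `W_cubic = {x | ∀ μ, ⟪x, μ⟫ ≤ φ_fcc μ}`;
so `W_A` is compact, convex, contains `0`, has volume `≥ 32` (`Literature…FccWulffBodyVolume`), and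
`Per_{W_A}(G) ≤ √5 · Per(G) < ∞` for sets of finite perimeter. WHAT THIS IS NOT: anything about
textures with two or more grains (the wall terms of P), nor about the Γ-liminf T.
-/

noncomputable section

namespace Summit.Ventures.Crystal3D.Theorems

open MeasureTheory Set Metric Filter
open scoped RealInnerProductSpace ENNReal
open Literature.MathematicalPhysics.StatisticalMechanics
open Literature.Geometry.DiscreteGeometry (fccKissingPattern layerShell IsArrangedIn
  isArrangedIn_layerShell_fcc')

/-! ### The unit shell of the Barlow-frame fcc is an isometric image of the cuboctahedron -/

/-- The twelve unit vectors of `Λ₀ = fccStacking 1 √(2/3)` are `L(fccKissingPattern)` for some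
linear isometry `L` of `ℝ³` (Hales's FCC pattern in layer coordinates). -/
theorem exists_linearIsometryEquiv_unitShell_eq :
    ∃ L : EuclideanSpace ℝ (Fin 3) ≃ₗᵢ[ℝ] EuclideanSpace ℝ (Fin 3),
      {w | w ∈ fccStacking 1 (Real.sqrt (2 / 3)) ∧ ‖w‖ = 1} =
        L '' (fccKissingPattern : Set (EuclideanSpace ℝ (Fin 3))) := by
  obtain ⟨A, hA⟩ := isArrangedIn_layerShell_fcc' (σ := (1 : ℝ)) (Or.inl rfl)
  let L : EuclideanSpace ℝ (Fin 3) ≃ₗᵢ[ℝ] EuclideanSpace ℝ (Fin 3) :=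
    A.toLinearIsometryEquiv rfl
  refine ⟨L, ?_⟩
  have hshell : {w | w ∈ fccStacking 1 (Real.sqrt (2 / 3)) ∧ ‖w‖ = 1} = barlowShell 1 (-1) :=
    barlowShell_one_neg_one_eq.symm
  rw [hshell]
  ext v
  rw [mem_barlowShell_iff, hA]
  constructor
  · rintro ⟨p, hp, hpv⟩
    refine ⟨p, hp, ?_⟩
    have : (2 : ℝ) • A p = (2 : ℝ) • v := hpv
    have h2 := smul_right_injective (EuclideanSpace ℝ (Fin 3)) (two_ne_zero (α := ℝ)) this
    simpa [L] using h2
  · rintro ⟨p, hp, rfl⟩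
    exact ⟨p, hp, by simp [L]⟩

/-- In the Barlow frame the crux's tension is `φ_fcc ∘ L⁻¹`:
`(√2/4) Σ_{w ∈ Λ₀, ‖w‖ = 1} |⟪w, ν⟫| = φ_fcc(L⁻¹ ν)`. -/
theorem phiBarlow_eq_phiFcc {L : EuclideanSpace ℝ (Fin 3) ≃ₗᵢ[ℝ] EuclideanSpace ℝ (Fin 3)}
    (hL : {w | w ∈ fccStacking 1 (Real.sqrt (2 / 3)) ∧ ‖w‖ = 1} =
      L '' (fccKissingPattern : Set (EuclideanSpace ℝ (Fin 3))))
    (ν : EuclideanSpace ℝ (Fin 3)) :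
    Real.sqrt 2 / 4 * ∑ᶠ w ∈ {w | w ∈ fccStacking 1 (Real.sqrt (2 / 3)) ∧ ‖w‖ = 1}, |⟪w, ν⟫| =
      phiFcc (L.symm ν) := by
  rw [hL, finsum_mem_image L.injective.injOn, finsum_mem_coe_finset, phiFcc_eq_bondSum]
  congr 1
  refine Finset.sum_congr rfl fun b _ => ?_
  rw [LinearIsometryEquiv.inner_map_eq_flip]

/-! ### The Wulff body in orientation `A` -/

/-- The Wulff body of the crux in orientation `A` is the isometric image `(A ∘ L)(W_cubic)` of
`W_cubic = {x | ∀ μ, ⟪x, μ⟫ ≤ φ_fcc μ}`. -/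
theorem wulffBody_eq_image {L : EuclideanSpace ℝ (Fin 3) ≃ₗᵢ[ℝ] EuclideanSpace ℝ (Fin 3)}
    (hL : {w | w ∈ fccStacking 1 (Real.sqrt (2 / 3)) ∧ ‖w‖ = 1} =
      L '' (fccKissingPattern : Set (EuclideanSpace ℝ (Fin 3))))
    (A : EuclideanSpace ℝ (Fin 3) ≃ₗᵢ[ℝ] EuclideanSpace ℝ (Fin 3)) :
    {y : EuclideanSpace ℝ (Fin 3) | ∀ ν : EuclideanSpace ℝ (Fin 3), ⟪y, ν⟫ ≤ Real.sqrt 2 / 4 *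
        ∑ᶠ w ∈ {w | w ∈ fccStacking 1 (Real.sqrt (2 / 3)) ∧ ‖w‖ = 1}, |⟪w, A.symm ν⟫|} =
      (L.trans A) '' {x | ∀ μ : EuclideanSpace ℝ (Fin 3), ⟪x, μ⟫ ≤ phiFcc μ} := by
  ext y
  rw [mem_setOf_eq, mem_image]
  constructor
  · intro hy
    refine ⟨(L.trans A).symm y, fun μ => ?_, by simp⟩
    have h := hy ((L.trans A) μ)
    rw [phiBarlow_eq_phiFcc hL] at h
    have e1 : L.symm (A.symm ((L.trans A) μ)) = μ := by simp [LinearIsometryEquiv.trans_apply]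
    rw [e1] at h
    rwa [LinearIsometryEquiv.inner_map_eq_flip, LinearIsometryEquiv.symm_symm]
  · rintro ⟨x, hx, rfl⟩ ν
    rw [mem_setOf_eq] at hx
    rw [phiBarlow_eq_phiFcc hL, LinearIsometryEquiv.inner_map_eq_flip]
    have e2 : (L.trans A).symm ν = L.symm (A.symm ν) := rfl
    rw [e2]
    exact hx _

/-- `W_cubic = {x | ∀ μ, ⟪x, μ⟫ ≤ φ_fcc μ}` is closed, bounded by `√5`, hence compact. -/
theorem isCompact_wulffCubic :
    IsCompact {x : EuclideanSpace ℝ (Fin 3) | ∀ μ : EuclideanSpace ℝ (Fin 3), ⟪x, μ⟫ ≤ phiFcc μ} := by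
  refine Metric.isCompact_of_isClosed_isBounded ?_ ?_
  · have : {x : EuclideanSpace ℝ (Fin 3) | ∀ μ : EuclideanSpace ℝ (Fin 3), ⟪x, μ⟫ ≤ phiFcc μ} =
        ⋂ μ, {x | ⟪x, μ⟫ ≤ phiFcc μ} := by ext; simp
    rw [this]
    exact isClosed_iInter fun μ => isClosed_le (continuous_id.inner continuous_const)
      continuous_const
  · refine (isBounded_closedBall (x := (0 : EuclideanSpace ℝ (Fin 3))) (r := Real.sqrt 5)).subset
      fun x hx => ?_
    rw [mem_closedBall, dist_zero_right]
    have h1 : ‖x‖ ^ 2 ≤ Real.sqrt 5 * ‖x‖ := by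
      rw [← real_inner_self_eq_norm_sq]
      exact (hx x).trans (phiFcc_le_sqrt_five_mul_norm x)
    nlinarith [norm_nonneg x, Real.sqrt_nonneg 5]

/-- Points of `W_cubic` have norm at most `√5` (`‖x‖² = ⟪x,x⟫ ≤ φ_fcc(x) ≤ √5 ‖x‖`). -/
theorem norm_le_of_mem_wulffCubic {x : EuclideanSpace ℝ (Fin 3)}
    (hx : ∀ μ : EuclideanSpace ℝ (Fin 3), ⟪x, μ⟫ ≤ phiFcc μ) : ‖x‖ ≤ Real.sqrt 5 := by
  have h1 : ‖x‖ ^ 2 ≤ Real.sqrt 5 * ‖x‖ := by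
    rw [← real_inner_self_eq_norm_sq]
    exact (hx x).trans (phiFcc_le_sqrt_five_mul_norm x)
  nlinarith [norm_nonneg x, Real.sqrt_nonneg 5]

/-! ### Bounded constraint bodies give finite `K`-perimeter on sets of finite perimeter -/

/-- If `K ⊆ B̄(0, R)` then the `K`-perimeter is at most `R` times De Giorgi's perimeter:
every admissible `K`-valued field, divided by `R`, is a unit test field. -/
theorem iSup_le_mul_perimeter {K : Set (EuclideanSpace ℝ (Fin 3))} {R : ℝ} (hR : 0 < R)
    (hK : ∀ y ∈ K, ‖y‖ ≤ R) (G : Set (EuclideanSpace ℝ (Fin 3))) :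
    (⨆ (ξ : EuclideanSpace ℝ (Fin 3) → EuclideanSpace ℝ (Fin 3))
        (_ : ContDiff ℝ 1 ξ ∧ HasCompactSupport ξ ∧ ∀ z, ξ z ∈ K),
        ENNReal.ofReal (∫ z in G, fieldDivergence ξ z)) ≤ ENNReal.ofReal R * perimeter G := by
  refine iSup₂_le fun ξ hξ => ?_
  obtain ⟨hξ1, hξ2, hξK⟩ := hξ
  have hd : ∀ z, DifferentiableAt ℝ ξ z := fun z => (hξ1.differentiable one_ne_zero) z
  have hunit : IsUnitTestField (R⁻¹ • ξ) := by
    refine ⟨hξ1.const_smul R⁻¹, hξ2.smul_left, fun z => ?_⟩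
    rw [Pi.smul_apply, norm_smul, Real.norm_of_nonneg (inv_nonneg.2 hR.le)]
    calc R⁻¹ * ‖ξ z‖ ≤ R⁻¹ * R := by gcongr; exact hK _ (hξK z)
      _ = 1 := inv_mul_cancel₀ hR.ne'
  have hdiv : ∀ z, fieldDivergence ξ z = R * fieldDivergence (R⁻¹ • ξ) z := by
    intro z
    unfold fieldDivergence
    rw [fderiv_const_smul (hd z), ContinuousLinearMap.toLinearMap_smul, map_smul, smul_eq_mul,
      ← mul_assoc, mul_inv_cancel₀ hR.ne', one_mul]
  calc ENNReal.ofReal (∫ z in G, fieldDivergence ξ z)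
      = ENNReal.ofReal (R * ∫ z in G, fieldDivergence (R⁻¹ • ξ) z) := by
        rw [← integral_const_mul]
        exact congrArg _ (integral_congr_ae (Eventually.of_forall hdiv))
    _ = ENNReal.ofReal R * ENNReal.ofReal (∫ z in G, fieldDivergence (R⁻¹ • ξ) z) :=
        ENNReal.ofReal_mul hR.le
    _ ≤ ENNReal.ofReal R * perimeter G := mul_le_mul_right (le_perimeter hunit) _

/-! ### The single-grain Wulff inequality in the crux's normalisation -/

/-- The constant: `6 · 2^{1/3} · (√2 V)^{2/3} = 3 · 32^{1/3} · (V^{1/3})²` for `V ≥ 0`. -/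
theorem wulff_constant_eq {V : ℝ} (hV : 0 ≤ V) :
    6 * (2 : ℝ) ^ ((1 : ℝ) / 3) * (Real.sqrt 2 * V) ^ ((2 : ℝ) / 3) =
      3 * (32 : ℝ) ^ ((3 : ℝ)⁻¹) * (V ^ ((3 : ℝ)⁻¹)) ^ 2 := by
  set t : ℝ := (2 : ℝ) ^ ((1 : ℝ) / 3) with ht
  have h13 : ((3 : ℝ)⁻¹) = (1 : ℝ) / 3 := by norm_num
  have ht3 : t ^ 3 = 2 := by
    rw [ht, ← Real.rpow_mul_natCast (by norm_num)]; norm_num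
  have h32 : (32 : ℝ) ^ ((3 : ℝ)⁻¹) = t ^ 5 := by
    rw [h13, show (32 : ℝ) = 2 ^ (5 : ℕ) by norm_num, ← Real.rpow_natCast_mul (by norm_num),
      mul_comm, Real.rpow_mul_natCast (by norm_num)]
  have hsqrt : Real.sqrt 2 ^ ((2 : ℝ) / 3) = t := by
    rw [Real.sqrt_eq_rpow, ← Real.rpow_mul (by norm_num)]; norm_num [ht]
  have hV23 : V ^ ((2 : ℝ) / 3) = (V ^ ((3 : ℝ)⁻¹)) ^ 2 := by
    rw [← Real.rpow_mul_natCast hV]; norm_num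
  rw [Real.mul_rpow (Real.sqrt_nonneg 2) hV, hsqrt, hV23, h32]
  linear_combination (-3 * (V ^ ((3 : ℝ)⁻¹)) ^ 2 * t ^ 2) * ht3

/-- **`PolycrystalWulffBound`, single grain (the Wulff inequality for the fcc tension).** For every
orientation `A` and every set `G ⊆ ℝ³` of finite perimeter and finite volume,
`6·2^{1/3}·(√2·|G|)^{2/3} ≤ Per_{W_A}(G)` with `W_A` and `Per` exactly the `let`-bound Wulff body and
`K`-perimeter of the crux `PolycrystalWulffBound` (item `stmt-Ventures-19482`): the `n = 1` case of
the crux (no walls), i.e. the anisotropic isoperimetric inequality `P_{W}(G) ≥ 3|W|^{1/3}|G|^{2/3}`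
with `|W_A| = 32`. Unconditional (tree theorem `anisotropic_isoperimetric_inequality`). -/
theorem polycrystalWulffBound_singleGrain
    (A : EuclideanSpace ℝ (Fin 3) ≃ₗᵢ[ℝ] EuclideanSpace ℝ (Fin 3))
    {G : Set (EuclideanSpace ℝ (Fin 3))} (hG : HasFinitePerimeter G) (hvol : volume G < ⊤) :
    6 * (2 : ℝ) ^ ((1 : ℝ) / 3) * (Real.sqrt 2 * (volume G).toReal) ^ ((2 : ℝ) / 3) ≤
      (⨆ (ξ : EuclideanSpace ℝ (Fin 3) → EuclideanSpace ℝ (Fin 3))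
        (_ : ContDiff ℝ 1 ξ ∧ HasCompactSupport ξ ∧ ∀ z, ξ z ∈
          {y : EuclideanSpace ℝ (Fin 3) | ∀ ν : EuclideanSpace ℝ (Fin 3), ⟪y, ν⟫ ≤
            Real.sqrt 2 / 4 * ∑ᶠ w ∈ {w | w ∈ fccStacking 1 (Real.sqrt (2 / 3)) ∧ ‖w‖ = 1},
              |⟪w, A.symm ν⟫|}),
        ENNReal.ofReal (∫ z in G, fieldDivergence ξ z)).toReal := by
  obtain ⟨L, hL⟩ := exists_linearIsometryEquiv_unitShell_eq
  set W : Set (EuclideanSpace ℝ (Fin 3)) := {y | ∀ ν : EuclideanSpace ℝ (Fin 3), ⟪y, ν⟫ ≤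
      Real.sqrt 2 / 4 * ∑ᶠ w ∈ {w | w ∈ fccStacking 1 (Real.sqrt (2 / 3)) ∧ ‖w‖ = 1},
        |⟪w, A.symm ν⟫|} with hW
  set Wc : Set (EuclideanSpace ℝ (Fin 3)) := {x | ∀ μ : EuclideanSpace ℝ (Fin 3), ⟪x, μ⟫ ≤ phiFcc μ}
    with hWc
  have hWeq : W = (L.trans A) '' Wc := wulffBody_eq_image hL A
  -- the hypotheses of the isoperimetric inequality
  have hWcpt : IsCompact W := by
    rw [hWeq]; exact isCompact_wulffCubic.image (L.trans A).continuous
  have hWconv : Convex ℝ W := by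
    intro y hy y' hy' a b ha hb hab ν
    have h1 := mul_le_mul_of_nonneg_left (hy ν) ha
    have h2 := mul_le_mul_of_nonneg_left (hy' ν) hb
    rw [inner_add_left, real_inner_smul_left, real_inner_smul_left]
    refine (add_le_add h1 h2).trans (le_of_eq ?_)
    rw [← add_mul, hab, one_mul]
  have h0W : (0 : EuclideanSpace ℝ (Fin 3)) ∈ W := by
    intro ν
    rw [inner_zero_left, phiBarlow_eq_phiFcc hL]
    exact phiFcc_nonneg _
  have hWvol : ENNReal.ofReal 32 ≤ volume W := by
    rw [hWeq, LinearIsometryEquiv.image_eq_preimage_symm,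
      (L.trans A).symm.measurePreserving.measure_preimage
        isCompact_wulffCubic.measurableSet.nullMeasurableSet]
    exact le_volume_fccWulffSet
  have hWbd : ∀ y ∈ W, ‖y‖ ≤ Real.sqrt 5 := by
    intro y hy
    rw [hWeq] at hy
    obtain ⟨x, hx, rfl⟩ := hy
    rw [LinearIsometryEquiv.norm_map]
    exact norm_le_of_mem_wulffCubic hx
  -- finiteness of the `W`-perimeter
  set P := ⨆ (ξ : EuclideanSpace ℝ (Fin 3) → EuclideanSpace ℝ (Fin 3))
        (_ : ContDiff ℝ 1 ξ ∧ HasCompactSupport ξ ∧ ∀ z, ξ z ∈ W),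
        ENNReal.ofReal (∫ z in G, fieldDivergence ξ z) with hP
  have hPfin : P < ⊤ :=
    (iSup_le_mul_perimeter (Real.sqrt_pos.2 (by norm_num)) hWbd G).trans_lt
      (ENNReal.mul_lt_top ENNReal.ofReal_lt_top hG.2)
  -- the isoperimetric inequality with `n = 3`
  have hmain := Literature.Analysis.Convexity.anisotropic_isoperimetric_inequality (n := 3)
    (by norm_num) hWcpt hWconv h0W hG.1 hvol
  have hlow : (3 : ℝ≥0∞) * ENNReal.ofReal 32 ^ ((3 : ℝ)⁻¹) *
      (volume G ^ ((3 : ℝ)⁻¹)) ^ 2 ≤ P := by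
    refine le_trans ?_ hmain
    simp only [Nat.cast_ofNat, show (3 : ℕ) - 1 = 2 from rfl]
    gcongr
  -- pass to real numbers
  set V : ℝ := (volume G).toReal with hV
  have hV0 : 0 ≤ V := ENNReal.toReal_nonneg
  have hvolV : volume G = ENNReal.ofReal V := (ENNReal.ofReal_toReal hvol.ne).symm
  have hlow' : ENNReal.ofReal (3 * (32 : ℝ) ^ ((3 : ℝ)⁻¹) * (V ^ ((3 : ℝ)⁻¹)) ^ 2) ≤
      ENNReal.ofReal P.toReal := by
    rw [ENNReal.ofReal_toReal hPfin.ne]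
    refine le_trans (le_of_eq ?_) hlow
    rw [hvolV, ENNReal.ofReal_mul (by positivity), ENNReal.ofReal_mul (by positivity),
      ENNReal.ofReal_pow (by positivity), ENNReal.ofReal_rpow_of_nonneg (by positivity) (by positivity),
      ENNReal.ofReal_rpow_of_nonneg hV0 (by positivity), ENNReal.ofReal_ofNat]
  have hreal : 3 * (32 : ℝ) ^ ((3 : ℝ)⁻¹) * (V ^ ((3 : ℝ)⁻¹)) ^ 2 ≤ P.toReal :=
    (ENNReal.ofReal_le_ofReal_iff ENNReal.toReal_nonneg).1 hlow'
  rw [wulff_constant_eq hV0]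
  exact hreal

/-! ### The `n = 1` case of the crux, verbatim -/

open scoped InnerProductSpace in
/-- **`PolycrystalWulffBound` holds for one-grain textures** (`n = 1`): the crux's statement with its
`let`-bindings copied verbatim and the number of grains specialised to `1`. The two wall double sums
vanish on the diagonal `f = g`, `Vol 1 G = |G 0|`, and the single-grain inequality applies. This also
certifies that `polycrystalWulffBound_singleGrain` is stated in the crux's exact normalisation. -/
theorem polycrystalWulffBound_n_one :
    let Λ : Set (EuclideanSpace ℝ (Fin 3)) := Literature.MathematicalPhysics.StatisticalMechanics.fccStacking 1 (Real.sqrt (2 / 3));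
    let Brl : (ℤ → ℤ) → Set (EuclideanSpace ℝ (Fin 3)) := Literature.MathematicalPhysics.StatisticalMechanics.barlowStacking 1 (Real.sqrt (2 / 3));
    let Ax : EuclideanSpace ℝ (Fin 3) → (EuclideanSpace ℝ (Fin 3) ≃ₗᵢ[ℝ] EuclideanSpace ℝ (Fin 3)) → (EuclideanSpace ℝ (Fin 3) ≃ₗᵢ[ℝ] EuclideanSpace ℝ (Fin 3)) → Prop := fun m A B => ∃ (L : EuclideanSpace ℝ (Fin 3) ≃ₗᵢ[ℝ] EuclideanSpace ℝ (Fin 3)) (s₁ s₂ : EuclideanSpace ℝ (Fin 3)) (σ σ' : ℤ → ℤ), Literature.MathematicalPhysics.StatisticalMechanics.IsHaggSeq σ ∧ Literature.MathematicalPhysics.StatisticalMechanics.IsHaggSeq σ' ∧ L (EuclideanSpace.single (2 : Fin 3) (1 : ℝ)) = m ∧ A '' Λ ⊆ (fun q => L q + s₁) '' Brl σ ∧ B '' Λ ⊆ (fun q => L q + s₂) '' Brl σ';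
    let CoAx : (EuclideanSpace ℝ (Fin 3) ≃ₗᵢ[ℝ] EuclideanSpace ℝ (Fin 3)) → (EuclideanSpace ℝ (Fin 3) ≃ₗᵢ[ℝ] EuclideanSpace ℝ (Fin 3)) → Prop := fun A B => ∃ m, Ax m A B;
    let Φ : EuclideanSpace ℝ (Fin 3) → ℝ := fun ν => Real.sqrt 2 / 4 * ∑ᶠ w ∈ {w ∈ Λ | ‖w‖ = 1}, |⟪w, ν⟫_ℝ|;
    let Per : Set (EuclideanSpace ℝ (Fin 3)) → Set (EuclideanSpace ℝ (Fin 3)) → ℝ := fun K S => (⨆ (ξ : EuclideanSpace ℝ (Fin 3) → EuclideanSpace ℝ (Fin 3)) (_ : ContDiff ℝ 1 ξ ∧ HasCompactSupport ξ ∧ ∀ z, ξ z ∈ K), ENNReal.ofReal (∫ z in S, Literature.MathematicalPhysics.StatisticalMechanics.fieldDivergence ξ z)).toReal;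
    let ι : Set (EuclideanSpace ℝ (Fin 3)) → Set (EuclideanSpace ℝ (Fin 3)) → Set (EuclideanSpace ℝ (Fin 3)) → ℝ := fun K S₁ S₂ => (Per K S₁ + Per K S₂ - Per K (S₁ ∪ S₂)) / 2;
    let W : (EuclideanSpace ℝ (Fin 3) ≃ₗᵢ[ℝ] EuclideanSpace ℝ (Fin 3)) → Set (EuclideanSpace ℝ (Fin 3)) := fun A => {y | ∀ ν : EuclideanSpace ℝ (Fin 3), ⟪y, ν⟫_ℝ ≤ Φ (A.symm ν)};
    let Dsc : EuclideanSpace ℝ (Fin 3) → Set (EuclideanSpace ℝ (Fin 3)) := fun m => {y | ‖y‖ ≤ 1 ∧ ⟪y, m⟫_ℝ = 0};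
    let Tex : (n : ℕ) → (Fin n → Set (EuclideanSpace ℝ (Fin 3))) → (Fin n → (EuclideanSpace ℝ (Fin 3) ≃ₗᵢ[ℝ] EuclideanSpace ℝ (Fin 3))) → (Fin n → Fin n → ℝ) → (Fin n → Fin n → EuclideanSpace ℝ (Fin 3)) → Prop := fun n G A c m => (∀ f : Fin n, Literature.MathematicalPhysics.StatisticalMechanics.HasFinitePerimeter (G f) ∧ volume (G f) < ⊤) ∧ (∀ f g, f ≠ g → Disjoint (G f) (G g)) ∧ (∀ f g, f ≠ g → 0 ≤ c f g) ∧ (∀ f g, f ≠ g → ¬ CoAx (A f) (A g) → m f g = 0 ∧ 1 ≤ c f g) ∧ (∀ f g, f ≠ g → CoAx (A f) (A g) → A f '' Λ ≠ A g '' Λ → Ax (m f g) (A f) (A g) ∧ 1 / 2 ≤ c f g);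
    let En : (n : ℕ) → (Fin n → Set (EuclideanSpace ℝ (Fin 3))) → (Fin n → (EuclideanSpace ℝ (Fin 3) ≃ₗᵢ[ℝ] EuclideanSpace ℝ (Fin 3))) → (Fin n → Fin n → ℝ) → (Fin n → Fin n → EuclideanSpace ℝ (Fin 3)) → ℝ := fun n G A c m => ∑ f : Fin n, Per (W (A f)) (G f) - ∑ f, ∑ g, (if f = g then 0 else ι (W (A f)) (G f) (G g)) + ∑ f, ∑ g, (if f = g then 0 else c f g / 2 * ι (Dsc (m f g)) (G f) (G g));
    let Vol : (n : ℕ) → (Fin n → Set (EuclideanSpace ℝ (Fin 3))) → ℝ := fun n G => (volume (⋃ f : Fin n, G f)).toReal; ∀ (G : Fin 1 → Set (EuclideanSpace ℝ (Fin 3))) (A : Fin 1 → (EuclideanSpace ℝ (Fin 3) ≃ₗᵢ[ℝ] EuclideanSpace ℝ (Fin 3))) (c : Fin 1 → Fin 1 → ℝ) (m : Fin 1 → Fin 1 → EuclideanSpace ℝ (Fin 3)), Tex 1 G A c m → 6 * (2 : ℝ) ^ ((1 : ℝ) / 3) * (Real.sqrt 2 * Vol 1 G) ^ ((2 : ℝ)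 / 3) ≤ En 1 G A c m := by
  intro Λ Brl Ax CoAx Φ Per ι W Dsc Tex En Vol G A c m hTex
  obtain ⟨hfin, -, -, -, -⟩ := hTex
  have hEn : En 1 G A c m = Per (W (A 0)) (G 0) := by
    show (∑ f : Fin 1, Per (W (A f)) (G f) - ∑ f : Fin 1, ∑ g : Fin 1,
        (if f = g then 0 else ι (W (A f)) (G f) (G g)) +
        ∑ f : Fin 1, ∑ g : Fin 1, (if f = g then 0 else c f g / 2 * ι (Dsc (m f g)) (G f) (G g))) =
      Per (W (A 0)) (G 0)
    simp
  have hVol : Vol 1 G = (volume (G 0)).toReal := by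
    show (volume (⋃ f : Fin 1, G f)).toReal = (volume (G 0)).toReal
    rw [show (⋃ f : Fin 1, G f) = G 0 from by
      ext x; simp [Fin.exists_fin_one]]
  rw [hEn, hVol]
  exact polycrystalWulffBound_singleGrain (A 0) (hfin 0).1 (hfin 0).2


end Summit.Ventures.Crystal3D.Theorems

end
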